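import Summits.BirchSwinnertonDyer.BirchSwinnertonDyer.Theorems.ByReductionTypeAtTwoRankOneSigmaHeightValuation
import HarnessLib

/-!
# Route `ByReductionTypeAtTwo`, crux `RankOneAtTwoBigImageOddLocal` (item stmt-BirchSwinnertonDyer-23715), line AN62, σ₀-LEMMA BLOCK
# (cell `bsd-f1-sign2`, planner seat `-an` g50; `--supports 23715`, helper; sequel of `…SigmaHeightFirstOrder` / `…SigmaHeightValuation`):
# **THE NUMERATOR LAW — the naive `2`-adic σ-height of a deep point is `log₂` of the numerator of `x`, to SECOND order:
# `‖h(P) − log₂ num x(P)‖₂ ≤ 2‖x(P)‖₂⁻²` at `‖x(P)‖₂ ≥ 16`**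

HONEST FRAMING (D-0036/D-0054): THEOREMS ONLY (no definition, no named fact, no `sorry`, no instance).  For a `ℤ`-integral model `V/ℚ`
with `a₁ = 0`, its even constant-`0` sigma-squared series `Σ₀` at `2` (`Σ₀(0) = 0`, `[t]Σ₀ = 0`, `[t²]Σ₀ = 1`, `[t³]Σ₀ = 0`,
`SatisfiesSigmaSqODE Σ₀ 0`) and a non-singular rational point `P = (x, y)`, `h(P) := log₂ den x − log₂ Σ₀(−x/y)` is a NAIVE local
expression (the crux workfile's `etaHeightAtTwo`, written out); nothing here is a statement about `BSDp`; item 23715 stays OPEN; BSD is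
proved for no curve.

* §1 `norm_padicEval_sub_le_of_sigmaLog` — the tail of `L = log(Σ₀/t²)`: **`‖L(t) − (a₂t² + a₃t³)‖ ≤ 2‖t‖⁴`** on `‖t‖ ≤ ¼` (from 50A/50B:
  `l₁ = 0`, `l₂ = a₂`, `l₃ = a₃`, `‖l₄‖ ≤ 2`, `‖l_k‖ ≤ 2^{k−4}` for `k ≥ 5`).
* §3 **`norm_sigmaHeightTwo_sub_padicLog_num_le`** (MEMO-an 54A) — `‖h(P) − log₂ num x‖₂ ≤ 2·‖x‖₂⁻²` for `‖x‖₂ ≥ 16`.  Proof = the tree's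
  odd-`p` engine `norm_canonicalPAdicHeight_sub_le_aux` (`x·den x = num x`; `B := 1 − a₃t/x = x(1+u)t²` with `u = a₂/x + a₄/x² + a₆/x³`
  by the curve equation; `h − log₂ num x = log₂(1+u) − log₂ B − L(t)` using `log₂ Σ₀(t) = 2 log₂ t + L(t)`, 53H) pushed ONE ORDER
  FURTHER: `log₂(1+u) = a₂t² + O(2t⁴)`, `−log₂ B = a₃t³ + O(t⁴)`, `L(t) = a₂t² + a₃t³ + O(2t⁴)` — the `t²` AND the `t³` terms cancel
  (as power series `t²·x(t)·Σ₀(t) = 1 − (a₄/6)t⁴ + O(t⁶)`).  The tree's odd-`p`, canonical-σ analogue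
  `norm_canonicalPAdicHeight_sub_padicLog_num_le_sq` has error `‖x‖⁻¹` (there `[t²](x·σ_p²) ≠ 0` in general); for the EVEN constant-`0`
  normalisation the error is `2‖x‖⁻²`, which is what makes the valuation of `h(P)` readable off `num x (mod 2‖x‖²)` (sequel file
  `…SigmaHeightTateFormula`: `num x ≡ 1 (mod 8)`, `‖h(P)‖₂ = ‖num x − 1‖₂`, and the effective Tate formula).

PLACEMENT: the odd-`p` first-order numerator formula is [Mazur–Stein–Tate 2006, Rem. 1.4] / [Harvey 2008, §5 Lemma 8] (tree:
`…CanonicalPAdicHeightFirstOrderProofs`); a second-order statement at `p = 2` for the even constant-`0` σ² was not found in print (MEMO-an §54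
search log).  References: [cite: MazurSteinTate2006, §1 (1.1), Rem. 1.4, §2.7, §4] [cite: Harvey2008, §5, Lemma 8] [cite: Bernardi1981, §1]
[cite: SilvermanAEC2009, IV.1, VII.2.2] [cite: Iwasawa1972PadicL, §4.4].
-/

set_option autoImplicit false

noncomputable section

open scoped Classical

open PowerSeries WeierstrassCurve Literature Literature.NumberTheory.EllipticCurves

namespace Summit.BirchSwinnertonDyer.BirchSwinnertonDyer.Theorems

namespace NaiveSigmaLogAtTwo

/-! ### §1 The tail of `L = log(Σ₀/t²)` beyond order three -/

/-- **`‖L(t) − (a₂t² + a₃t³)‖ ≤ 2‖t‖⁴` on `‖t‖ ≤ ¼`** (generic over the hypotheses of 50B): termwise, `l₀ = l₁ = 0`, `l₂ = a₂`, `l₃ = a₃`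
are split off (`Summable.sum_add_tsum_nat_add`), `‖l₄t⁴‖ ≤ 2‖t‖⁴`, and `‖l_k t^k‖ ≤ 2^{k−4}4^{4−k}‖t‖⁴ ≤ ‖t‖⁴` for `k ≥ 5`.
[cite: Bernardi1981, §1] [cite: MazurSteinTate2006, §2.7] -/
theorem norm_padicEval_sub_le_of_sigmaLog (W : WeierstrassCurve ℚ_[2]) (Sq L : ℚ_[2]⟦X⟧) (t : ℚ_[2]) (ha1 : W.a₁ = 0)
    (ha2 : ‖W.a₂‖ ≤ 1) (ha3 : ‖W.a₃‖ ≤ 1) (ha4 : ‖W.a₄‖ ≤ 1) (ha6 : ‖W.a₆‖ ≤ 1)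
    (h2 : coeff 2 Sq = 1) (h3 : coeff 3 Sq = 0) (hODE : W.SatisfiesSigmaSqODE Sq 0) (hL0 : constantCoeff L = 0)
    (hL : sigmaShift (sigmaShift Sq) * d⁄dX ℚ_[2] L = d⁄dX ℚ_[2] (sigmaShift (sigmaShift Sq))) (ht : ‖t‖ ≤ (2⁻¹ : ℝ) ^ 2) :
    ‖padicEval L t - (W.a₂ * t ^ 2 + W.a₃ * t ^ 3)‖ ≤ 2 * ‖t‖ ^ 4 := by
  obtain ⟨hl1, hl2, hl3, hl4, hbound⟩ := naiveSigmaLog_denominators_two W Sq L ha1 ha2 ha3 ha4 ha6 h2 h3 hODE hL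
  have hl0 : coeff 0 L = 0 := by rw [coeff_zero_eq_constantCoeff]; exact hL0
  have ht0 : 0 ≤ ‖t‖ := norm_nonneg t
  have ht' : ‖t‖ ≤ 2⁻¹ := ht.trans (by norm_num)
  have hsum := (naiveSigmaLog_values_two W Sq L t ha1 ha2 ha3 ha4 ha6 h2 h3 hODE hL0 hL ht').1
  have h2n : ‖(2 : ℚ_[2])‖ = 2⁻¹ := by exact_mod_cast (Padic.norm_p (p := 2))
  have h3n : ‖(3 : ℚ_[2])‖ = 1 := by
    rw [show (3 : ℚ_[2]) = ((3 : ℕ) : ℚ_[2]) by norm_num, Padic.norm_natCast_eq_one_iff]; decide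
  have h5n : ‖(5 : ℚ_[2])‖ = 1 := by
    rw [show (5 : ℚ_[2]) = ((5 : ℕ) : ℚ_[2]) by norm_num, Padic.norm_natCast_eq_one_iff]; decide
  have h6n : ‖(6 : ℚ_[2])‖ = 2⁻¹ := by
    rw [show (6 : ℚ_[2]) = 2 * 3 by norm_num, norm_mul, h2n, h3n, mul_one]
  -- ‖l₄‖ ≤ 2
  have hl4n : ‖coeff 4 L‖ ≤ 2 := by
    rw [hl4]
    refine (IsUltrametricDist.norm_add_le_max _ _).trans (max_le ?_ ?_)
    · rw [norm_div, h2n, norm_pow]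
      calc ‖W.a₂‖ ^ 2 / 2⁻¹ = ‖W.a₂‖ ^ 2 * 2 := by ring
        _ ≤ 1 ^ 2 * 2 := by gcongr
        _ = 2 := by ring
    · rw [norm_div, norm_mul, h5n, h6n, one_mul]
      calc ‖W.a₄‖ / 2⁻¹ = ‖W.a₄‖ * 2 := by ring
        _ ≤ 1 * 2 := by gcongr
        _ = 2 := by ring
  -- ‖l_k‖ ≤ 2^{k−4} for k ≥ 5
  have hlk : ∀ k : ℕ, 5 ≤ k → ‖coeff k L‖ ≤ (2 : ℝ) ^ (k - 4) := by
    intro k hk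
    have hb := hbound k (by omega)
    have he := padicValNat_add_log_add_three_le hk
    have hpow : (2 : ℝ) ^ (padicValNat 2 k + Nat.log 2 (k - 1)) ≤ 2 ^ (k - 4) * 2 := by
      rw [← pow_succ]
      exact pow_le_pow_right₀ (by norm_num) (by omega)
    nlinarith [hb, hpow, norm_nonneg (coeff k L)]
  -- split off the head `l₀ + l₁t + l₂t² + l₃t³ = a₂t² + a₃t³`
  have hhead : padicEval L t - (W.a₂ * t ^ 2 + W.a₃ * t ^ 3) = ∑' i : ℕ, coeff (i + 4) L * t ^ (i + 4) := by
    unfold padicEval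
    rw [← hsum.sum_add_tsum_nat_add 4]
    simp only [Finset.sum_range_succ, Finset.sum_range_zero, zero_add, hl0, hl1, hl2, hl3, zero_mul]
    ring
  rw [hhead]
  refine IsUltrametricDist.norm_tsum_le_of_forall_le_of_nonneg (by positivity) fun i => ?_
  rw [norm_mul, norm_pow]
  rcases Nat.eq_zero_or_pos i with rfl | hi
  · rw [Nat.zero_add]
    exact mul_le_mul_of_nonneg_right hl4n (pow_nonneg ht0 4)
  · have hl := hlk (i + 4) (by omega)
    rw [Nat.add_sub_cancel] at hl
    have hgeom : (2 : ℝ) ^ i * ((2⁻¹ : ℝ) ^ 2) ^ i = (2⁻¹ : ℝ) ^ i := by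
      rw [← mul_pow]; norm_num
    calc ‖coeff (i + 4) L‖ * ‖t‖ ^ (i + 4) = (‖coeff (i + 4) L‖ * ‖t‖ ^ i) * ‖t‖ ^ 4 := by ring
      _ ≤ ((2 : ℝ) ^ i * ((2⁻¹ : ℝ) ^ 2) ^ i) * ‖t‖ ^ 4 :=
          mul_le_mul_of_nonneg_right (mul_le_mul hl (pow_le_pow_left₀ ht0 ht i) (pow_nonneg ht0 i) (by positivity))
            (pow_nonneg ht0 4)
      _ = (2⁻¹ : ℝ) ^ i * ‖t‖ ^ 4 := by rw [hgeom]
      _ ≤ 1 * ‖t‖ ^ 4 := by gcongr; exact pow_le_one₀ (by norm_num) (by norm_num)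
      _ ≤ 2 * ‖t‖ ^ 4 := by nlinarith [pow_nonneg ht0 4]

/-! ### §3 54A — the numerator law to second order -/

/-- **54A — THE NUMERATOR LAW (kernel): `‖(log₂ den x − log₂ Σ₀(−x/y)) − log₂ num x‖₂ ≤ 2·‖x‖₂⁻²` at `‖x‖₂ ≥ 16`** for a `ℤ`-integral
model with `a₁ = 0` and its even constant-`0` sigma-squared series `Σ₀`.  With `t = −x/y`, `u = a₂/x + a₄/x² + a₆/x³`, `B = 1 − a₃t/x = x(1+u)t²`
(curve equation): `h − log₂ num x = log₂(1+u) − log₂ B − L(t)` (`log₂ Σ₀(t) = 2log₂ t + L(t)`, 53H), and to second order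
`log₂(1+u) ≡ a₂t²`, `−log₂ B ≡ a₃t³`, `L(t) ≡ a₂t² + a₃t³` modulo terms of norm `≤ 2‖t‖⁴ = 2‖x‖⁻²`.  The `2`-adic, naive-even-σ analogue of
the tree's `norm_canonicalPAdicHeight_sub_padicLog_num_le_sq` (odd `p`, error `‖x‖⁻¹`), one order sharper.
[cite: MazurSteinTate2006, §1 (1.1), Rem. 1.4, §2.7] [cite: Harvey2008, §5, Lemma 8] [cite: Bernardi1981, §1] -/
theorem norm_sigmaHeightTwo_sub_padicLog_num_le (V : WeierstrassCurve ℚ) [V.IsIntegral ℤ] {x y : ℚ} (h : V.toAffine.Nonsingular x y)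
    (ha1 : V.a₁ = 0) (Sq : ℚ_[2]⟦X⟧) (h0 : constantCoeff Sq = 0) (h1 : coeff 1 Sq = 0) (h2 : coeff 2 Sq = 1) (h3 : coeff 3 Sq = 0)
    (hODE : (V.baseChange ℚ_[2]).SatisfiesSigmaSqODE Sq 0) (hx : (16 : ℝ) ≤ ‖(x : ℚ_[2])‖) :
    ‖(padicLog 2 (x.den : ℚ_[2]) - padicLog 2 (padicEval Sq (-(x : ℚ_[2]) / y))) - padicLog 2 (x.num : ℚ_[2])‖ ≤
      2 * ‖(x : ℚ_[2])‖⁻¹ ^ 2 := by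
  obtain ⟨e1, e2, e3, e4, e6⟩ := baseChange_padic_two_a V
  have ha1' : (V.baseChange ℚ_[2]).a₁ = 0 := by rw [e1, ha1, Rat.cast_zero]
  have hA2 : ‖(V.a₂ : ℚ_[2])‖ ≤ 1 := (mem_localIntegers_iff 2 _).mp (V.a₂_mem_localIntegers 2)
  have hA3 : ‖(V.a₃ : ℚ_[2])‖ ≤ 1 := (mem_localIntegers_iff 2 _).mp (V.a₃_mem_localIntegers 2)
  have hA4 : ‖(V.a₄ : ℚ_[2])‖ ≤ 1 := (mem_localIntegers_iff 2 _).mp (V.a₄_mem_localIntegers 2)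
  have hA6 : ‖(V.a₆ : ℚ_[2])‖ ≤ 1 := (mem_localIntegers_iff 2 _).mp (V.a₆_mem_localIntegers 2)
  have ha2 : ‖(V.baseChange ℚ_[2]).a₂‖ ≤ 1 := by rw [e2]; exact hA2
  have ha3 : ‖(V.baseChange ℚ_[2]).a₃‖ ≤ 1 := by rw [e3]; exact hA3
  have ha4 : ‖(V.baseChange ℚ_[2]).a₄‖ ≤ 1 := by rw [e4]; exact hA4
  have ha6 : ‖(V.baseChange ℚ_[2]).a₆‖ ≤ 1 := by rw [e6]; exact hA6
  obtain ⟨L, hL0, hL⟩ := exists_sigmaLog_two Sq h2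
  have hx1 : 1 < ‖(x : ℚ_[2])‖ := by linarith
  have hsq := WeierstrassCurve.norm_div_sq_eq_inv_norm_of_one_lt_norm h hx1
  set X : ℚ_[2] := (x : ℚ_[2]) with hXdef
  set Y : ℚ_[2] := (y : ℚ_[2]) with hYdef
  have hX0 : X ≠ 0 := fun e => by rw [e, norm_zero] at hx1; linarith
  have hY0 : Y ≠ 0 := by
    intro e
    rw [e, div_zero, norm_zero, zero_pow two_ne_zero] at hsq
    exact (inv_ne_zero (norm_ne_zero_iff.mpr hX0)) hsq.symm
  set t : ℚ_[2] := -X / Y with htdef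
  have ht0 : t ≠ 0 := div_ne_zero (neg_ne_zero.mpr hX0) hY0
  have htpos : 0 < ‖t‖ := norm_pos_iff.mpr ht0
  have htn0 : 0 ≤ ‖t‖ := norm_nonneg t
  have htn : ‖t‖ ^ 2 = ‖X‖⁻¹ := by rw [htdef, neg_div, norm_neg, hsq]
  have ht4 : ‖t‖ ≤ (2⁻¹ : ℝ) ^ 2 := by
    have h16 : ‖t‖ ^ 2 ≤ ((2⁻¹ : ℝ) ^ 2) ^ 2 := by
      rw [htn]
      calc ‖X‖⁻¹ ≤ (16 : ℝ)⁻¹ := by gcongr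
        _ = ((2⁻¹ : ℝ) ^ 2) ^ 2 := by norm_num
    exact (pow_le_pow_iff_left₀ (norm_nonneg _) (by positivity) two_ne_zero).mp h16
  have ht2le : ‖t‖ ^ 2 ≤ 16⁻¹ :=
    calc ‖t‖ ^ 2 ≤ ((2⁻¹ : ℝ) ^ 2) ^ 2 := pow_le_pow_left₀ htn0 ht4 2
      _ = 16⁻¹ := by norm_num
  have key := padicLog_padicEval_sigmaSq_two (V.baseChange ℚ_[2]) Sq L ha1' ha2 ha3 ha4 ha6 h0 h1 h2 h3 hODE hL0 hL t ht0 ht4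
  have htail := norm_padicEval_sub_le_of_sigmaLog (V.baseChange ℚ_[2]) Sq L t ha1' ha2 ha3 ha4 ha6 h2 h3 hODE hL0 hL ht4
  rw [e2, e3] at htail
  have h2n : ‖(2 : ℚ_[2])⁻¹‖ = 2 := by rw [norm_inv, Rank2Observatory.padic_norm_two, inv_inv]
  -- the curve equation in `ℚ₂` (`a₁ = 0`)
  have heq : Y ^ 2 + (V.a₃ : ℚ_[2]) * Y = X ^ 3 + (V.a₂ : ℚ_[2]) * X ^ 2 + (V.a₄ : ℚ_[2]) * X + (V.a₆ : ℚ_[2]) := by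
    have e := (WeierstrassCurve.Affine.equation_iff x y).mp h.1
    have e' := congrArg (fun q : ℚ => (q : ℚ_[2])) e
    push_cast at e'
    have ea : ((V.toAffine.a₁ : ℚ) : ℚ_[2]) = 0 := by rw [show V.toAffine.a₁ = V.a₁ from rfl, ha1, Rat.cast_zero]
    rw [ea, zero_mul, zero_mul, add_zero] at e'
    exact e'
  -- `u` and its norms
  have hX1 : 1 ≤ ‖X‖ := hx1.le
  have hXi1 : ‖X‖⁻¹ ≤ 1 := inv_le_one_of_one_le₀ hX1
  have hXinv : ‖X‖⁻¹ = ‖t‖ ^ 2 := htn.symm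
  set u : ℚ_[2] := (V.a₂ : ℚ_[2]) / X + (V.a₄ : ℚ_[2]) / X ^ 2 + (V.a₆ : ℚ_[2]) / X ^ 3 with hudef
  have hterm : ∀ (a : ℚ_[2]) (k : ℕ), ‖a‖ ≤ 1 → ‖a / X ^ k‖ ≤ ‖X‖⁻¹ ^ k := by
    intro a k ha
    rw [norm_div, norm_pow, inv_pow]
    calc ‖a‖ / ‖X‖ ^ k ≤ 1 / ‖X‖ ^ k := by gcongr
      _ = (‖X‖ ^ k)⁻¹ := one_div _
  have hterm' : ∀ (a : ℚ_[2]) (k j : ℕ), ‖a‖ ≤ 1 → j ≤ k → ‖a / X ^ k‖ ≤ ‖X‖⁻¹ ^ j := fun a k j ha hjk =>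
    (hterm a k ha).trans (pow_le_pow_of_le_one (by positivity) hXi1 hjk)
  have hu : ‖u‖ ≤ ‖t‖ ^ 2 := by
    rw [← hXinv, ← pow_one ‖X‖⁻¹]
    refine (IsUltrametricDist.norm_add_le_max _ _).trans (max_le ?_ (hterm' _ 3 1 hA6 (by omega)))
    refine (IsUltrametricDist.norm_add_le_max _ _).trans (max_le ?_ (hterm' _ 2 1 hA4 (by omega)))
    simpa using hterm' _ 1 1 hA2 le_rfl
  have hE2 : ‖u - (V.a₂ : ℚ_[2]) / X‖ ≤ ‖t‖ ^ 4 := by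
    rw [show u - (V.a₂ : ℚ_[2]) / X = (V.a₄ : ℚ_[2]) / X ^ 2 + (V.a₆ : ℚ_[2]) / X ^ 3 by rw [hudef]; ring,
      show ‖t‖ ^ 4 = ‖X‖⁻¹ ^ 2 by rw [hXinv]; ring]
    exact (IsUltrametricDist.norm_add_le_max _ _).trans (max_le (hterm' _ 2 2 hA4 le_rfl) (hterm' _ 3 2 hA6 (by omega)))
  have hu1 : ‖u‖ < 1 := lt_of_le_of_lt (hu.trans ht2le) (by norm_num)
  have h1u : ‖1 - (1 + u)‖ < 1 := by rwa [sub_add_cancel_left, norm_neg]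
  have h1u0 : 1 + u ≠ 0 := by
    intro h0; rw [h0, sub_zero, norm_one] at h1u; exact lt_irrefl _ h1u
  have hn1u : ‖1 + u‖ = 1 := by
    have hne : ‖(1 : ℚ_[2])‖ ≠ ‖u‖ := by rw [norm_one]; exact (ne_of_lt hu1).symm
    rw [Padic.add_eq_max_of_ne hne, norm_one, max_eq_left hu1.le]
  -- `B = 1 − a₃t/x = x(1+u)t²`
  set B : ℚ_[2] := 1 - (V.a₃ : ℚ_[2]) * t / X with hBdef
  have hB : B = X * (1 + u) * t ^ 2 := by
    rw [hBdef, hudef, htdef]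
    field_simp
    linear_combination heq
  have hA3t : ‖(V.a₃ : ℚ_[2]) * t / X‖ ≤ ‖t‖ ^ 3 := by
    rw [norm_div, norm_mul]
    calc ‖(V.a₃ : ℚ_[2])‖ * ‖t‖ / ‖X‖ ≤ 1 * ‖t‖ / ‖X‖ := by gcongr
      _ = ‖t‖ * ‖X‖⁻¹ := by ring
      _ = ‖t‖ ^ 3 := by rw [hXinv]; ring
  have ht3 : ‖t‖ ^ 3 ≤ ‖t‖ ^ 2 := pow_le_pow_of_le_one htn0 (ht4.trans (by norm_num)) (by norm_num)
  have h1B : ‖1 - B‖ ≤ ‖t‖ ^ 3 := by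
    have : 1 - B = (V.a₃ : ℚ_[2]) * t / X := by rw [hBdef]; ring
    rw [this]; exact hA3t
  have h1B1 : ‖1 - B‖ < 1 := lt_of_le_of_lt (h1B.trans (ht3.trans ht2le)) (by norm_num)
  have hB0 : B ≠ 0 := by
    rw [hB]; exact mul_ne_zero (mul_ne_zero hX0 h1u0) (pow_ne_zero 2 ht0)
  have hnB : ‖B‖ = 1 := by
    have e : B = 1 + -(1 - B) := by ring
    have hne : ‖(1 : ℚ_[2])‖ ≠ ‖-(1 - B)‖ := by rw [norm_one, norm_neg]; exact (ne_of_lt h1B1).symm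
    rw [e, Padic.add_eq_max_of_ne hne, norm_one, norm_neg, max_eq_left h1B1.le]
  -- `1/x = (1+u)t²/B`: the corrections `a₂/x − a₂t²` and `a₃t/x − a₃t³`
  have hgap : ‖u + (V.a₃ : ℚ_[2]) * t / X‖ ≤ ‖t‖ ^ 2 :=
    (IsUltrametricDist.norm_add_le_max _ _).trans (max_le hu (hA3t.trans ht3))
  have hinvX : X⁻¹ - t ^ 2 = t ^ 2 * ((u + (V.a₃ : ℚ_[2]) * t / X) / B) := by
    have e1 : X⁻¹ = (1 + u) * t ^ 2 / B := by
      rw [hB]; field_simp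
    have e2 : u + (V.a₃ : ℚ_[2]) * t / X = (1 + u) - B := by rw [hBdef]; ring
    rw [e1, e2]
    field_simp
  have hcorr : ‖X⁻¹ - t ^ 2‖ ≤ ‖t‖ ^ 4 := by
    rw [hinvX, norm_mul, norm_div, hnB, div_one, norm_pow]
    calc ‖t‖ ^ 2 * ‖u + (V.a₃ : ℚ_[2]) * t / X‖ ≤ ‖t‖ ^ 2 * ‖t‖ ^ 2 := by gcongr
      _ = ‖t‖ ^ 4 := by ring
  have hE3 : ‖(V.a₂ : ℚ_[2]) / X - (V.a₂ : ℚ_[2]) * t ^ 2‖ ≤ ‖t‖ ^ 4 := by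
    rw [show (V.a₂ : ℚ_[2]) / X - (V.a₂ : ℚ_[2]) * t ^ 2 = (V.a₂ : ℚ_[2]) * (X⁻¹ - t ^ 2) by ring, norm_mul]
    calc ‖(V.a₂ : ℚ_[2])‖ * ‖X⁻¹ - t ^ 2‖ ≤ 1 * ‖t‖ ^ 4 := by gcongr
      _ = ‖t‖ ^ 4 := one_mul _
  have hE5 : ‖(V.a₃ : ℚ_[2]) * t / X - (V.a₃ : ℚ_[2]) * t ^ 3‖ ≤ ‖t‖ ^ 4 := by
    rw [show (V.a₃ : ℚ_[2]) * t / X - (V.a₃ : ℚ_[2]) * t ^ 3 = (V.a₃ : ℚ_[2]) * t * (X⁻¹ - t ^ 2) by ring, norm_mul, norm_mul]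
    calc ‖(V.a₃ : ℚ_[2])‖ * ‖t‖ * ‖X⁻¹ - t ^ 2‖ ≤ 1 * 1 * ‖t‖ ^ 4 := by
          gcongr; exact ht4.trans (by norm_num)
      _ = ‖t‖ ^ 4 := by ring
  -- second-order logarithms
  have hE1 : ‖padicLog 2 (1 + u) - u‖ ≤ 2 * ‖t‖ ^ 4 := by
    rw [padicLog_eq_padicLogSeries h1u]
    have hh := norm_padicLogSeries_add_le (p := 2) h1u
    rw [show (1 : ℚ_[2]) - (1 + u) = -u by ring, norm_neg, ← sub_eq_add_neg] at hh
    calc ‖padicLogSeries 2 (1 + u) - u‖ ≤ ‖u‖ ^ 2 * ‖(2 : ℚ_[2])⁻¹‖ := hh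
      _ ≤ (‖t‖ ^ 2) ^ 2 * 2 := by rw [h2n]; gcongr
      _ = 2 * ‖t‖ ^ 4 := by ring
  have hE4 : ‖padicLog 2 B + (V.a₃ : ℚ_[2]) * t / X‖ ≤ ‖t‖ ^ 4 := by
    rw [padicLog_eq_padicLogSeries h1B1]
    have hh := norm_padicLogSeries_add_le (p := 2) h1B1
    have e : (1 : ℚ_[2]) - B = (V.a₃ : ℚ_[2]) * t / X := by rw [hBdef]; ring
    rw [e] at hh
    calc ‖padicLogSeries 2 B + (V.a₃ : ℚ_[2]) * t / X‖ ≤ ‖(V.a₃ : ℚ_[2]) * t / X‖ ^ 2 * ‖(2 : ℚ_[2])⁻¹‖ := hh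
      _ ≤ (‖t‖ ^ 3) ^ 2 * 2 := by rw [h2n]; gcongr
      _ = ‖t‖ ^ 4 * (2 * ‖t‖ ^ 2) := by ring
      _ ≤ ‖t‖ ^ 4 * 1 := by gcongr; linarith [ht2le]
      _ = ‖t‖ ^ 4 := mul_one _
  -- numerator and denominator, and the main identity
  have hx0 : x ≠ 0 := by rintro rfl; exact hX0 (by rw [hXdef, Rat.cast_zero])
  have hnum0 : (x.num : ℚ_[2]) ≠ 0 := by exact_mod_cast Rat.num_ne_zero.mpr hx0
  have hden0 : (x.den : ℚ_[2]) ≠ 0 := by exact_mod_cast x.den_nz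
  have hXnd : X = (x.num : ℚ_[2]) / (x.den : ℚ_[2]) := by rw [hXdef]; exact_mod_cast (Rat.num_div_den x).symm
  have hden : (x.den : ℚ_[2]) = (x.num : ℚ_[2]) * X⁻¹ := by
    rw [hXnd, inv_div, mul_div_cancel₀ _ hnum0]
  have hLinv : padicLog 2 X⁻¹ = -padicLog 2 X := by
    have hm := padicLog_mul_holds 2 hX0 (inv_ne_zero hX0)
    rw [mul_inv_cancel₀ hX0, padicLog_one] at hm
    linear_combination -hm
  have hLden : padicLog 2 (x.den : ℚ_[2]) = padicLog 2 (x.num : ℚ_[2]) - padicLog 2 X := by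
    rw [hden, padicLog_mul_holds 2 hnum0 (inv_ne_zero hX0), hLinv]; ring
  have hLB : padicLog 2 B = padicLog 2 X + padicLog 2 (1 + u) + 2 * padicLog 2 t := by
    rw [hB, padicLog_mul_holds 2 (mul_ne_zero hX0 h1u0) (pow_ne_zero 2 ht0), padicLog_mul_holds 2 hX0 h1u0, padicLog_sq ht0]
  have hmain : (padicLog 2 (x.den : ℚ_[2]) - padicLog 2 (padicEval Sq t)) - padicLog 2 (x.num : ℚ_[2]) =
      (padicLog 2 (1 + u) - u) + (u - (V.a₂ : ℚ_[2]) / X) + ((V.a₂ : ℚ_[2]) / X - (V.a₂ : ℚ_[2]) * t ^ 2) +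
        -(padicLog 2 B + (V.a₃ : ℚ_[2]) * t / X) + ((V.a₃ : ℚ_[2]) * t / X - (V.a₃ : ℚ_[2]) * t ^ 3) +
        -(padicEval L t - ((V.a₂ : ℚ_[2]) * t ^ 2 + (V.a₃ : ℚ_[2]) * t ^ 3)) := by
    rw [key, hLden]; linear_combination hLB
  have two4 : ‖t‖ ^ 4 ≤ 2 * ‖t‖ ^ 4 := by linarith [pow_nonneg htn0 4]
  have hfin : ‖(padicLog 2 (1 + u) - u) + (u - (V.a₂ : ℚ_[2]) / X) + ((V.a₂ : ℚ_[2]) / X - (V.a₂ : ℚ_[2]) * t ^ 2) +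
        -(padicLog 2 B + (V.a₃ : ℚ_[2]) * t / X) + ((V.a₃ : ℚ_[2]) * t / X - (V.a₃ : ℚ_[2]) * t ^ 3) +
        -(padicEval L t - ((V.a₂ : ℚ_[2]) * t ^ 2 + (V.a₃ : ℚ_[2]) * t ^ 3))‖ ≤ 2 * ‖t‖ ^ 4 := by
    refine (IsUltrametricDist.norm_add_le_max _ _).trans (max_le ?_ (by rw [norm_neg]; exact htail))
    refine (IsUltrametricDist.norm_add_le_max _ _).trans (max_le ?_ (hE5.trans two4))
    refine (IsUltrametricDist.norm_add_le_max _ _).trans (max_le ?_ (by rw [norm_neg]; exact hE4.trans two4))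
    refine (IsUltrametricDist.norm_add_le_max _ _).trans (max_le ?_ (hE3.trans two4))
    exact (IsUltrametricDist.norm_add_le_max _ _).trans (max_le hE1 (hE2.trans two4))
  rw [hmain]
  calc _ ≤ 2 * ‖t‖ ^ 4 := hfin
    _ = 2 * ‖X‖⁻¹ ^ 2 := by rw [hXinv]; ring

end NaiveSigmaLogAtTwo

end Summit.BirchSwinnertonDyer.BirchSwinnertonDyer.Theorems
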